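import Summits.Schanuel.Schanuel.Theorems.RootDecomp1BTranscendencePackageFloor02

/-!
# `RootDecomp1BTranscendencePackageFloor` — part 03 of 05 (`RootDecomp1BTranscendencePackageFloor03`): §3 the twisted exponential `Shear.E = exp ∘ θ` (homomorphism onto `ℂˣ`, kernel `ℤτ`, torsion, polar dictionary, discontinuity `Shear.not_continuous_E`); §4 agreement with `exp` on `ℚ̄` and the TRANSFER of Lindemann–Weierstrass / Hermite–Lindemann / Gelfond–Schneider / Baker to `E` from the tree's discharged facts

See part 01 (`Summits.Schanuel.Schanuel.Theorems.RootDecomp1BTranscendencePackageFloor01`) for the overview of the port (decomp-schanuel lens-4, gens 16–17; `--supports stmt-Schanuel-24622`; sorry-free, standard axioms; nothing here proves Schanuel — rung 0).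
-/

noncomputable section

open Complex

set_option linter.dupNamespace false

namespace Summit.Schanuel.Schanuel.Theorems.RootDecomp1BTranscendencePackageFloor

/-! ## §3 The twisted exponential `E = exp ∘ θ` -/

namespace Shear

variable (S : Shear)

/-- `θₗ` is `θ`. [folklore] -/
@[simp] theorem θₗ_apply (z : ℂ) : S.θₗ z = S.θ z := rfl
/-- `θQb` is `θ`. [folklore] -/
@[simp] theorem θQb_apply (z : ℂ) : S.θQb z = S.θ z := rfl

/-- `θ` is `ℤ`-linear. [folklore] -/
theorem θ_intCast_mul (n : ℤ) (z : ℂ) : S.θ (n * z) = n * S.θ z :=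
  S.θ_mul_of_mem (intCast_mem Qb n) z

/-- `θ⁻¹ (−z) = −θ⁻¹ z`. [folklore] -/
theorem θinv_neg (z : ℂ) : S.θinv (-z) = -S.θinv z := by
  have h := S.θinv_mul_of_mem (neg_mem (one_mem Qb)) z
  simpa using h

/-- The twisted exponential. [folklore] -/
def E (z : ℂ) : ℂ := cexp (S.θ z)

/-- `E z = e^{θ z}`. [folklore] -/
theorem E_apply (z : ℂ) : S.E z = cexp (S.θ z) := rfl

/-- `E` is a homomorphism `(ℂ, +) → (ℂ, ·)`. [folklore] -/
theorem E_add (z w : ℂ) : S.E (z + w) = S.E z * S.E w := by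
  rw [E, θ_add, Complex.exp_add]; rfl

/-- `E 0 = 1`. [folklore] -/
theorem E_zero : S.E 0 = 1 := by rw [E, θ_zero, Complex.exp_zero]

/-- `E` takes values in `ℂˣ`. [folklore] -/
theorem E_ne_zero (z : ℂ) : S.E z ≠ 0 := Complex.exp_ne_zero _

/-- `E` is `conj`-equivariant (because `θ` is and `exp` is). [folklore] -/
theorem E_conj (z : ℂ) : S.E ((starRingEnd ℂ) z) = (starRingEnd ℂ) (S.E z) := by
  rw [E_apply, E_apply, θ_conj]; exact Complex.exp_conj _

/-- `E` is onto `ℂˣ` (`θ` is onto and `exp` is onto `ℂˣ`). [folklore] -/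
theorem E_surjective {w : ℂ} (hw : w ≠ 0) : ∃ z, S.E z = w :=
  ⟨S.θinv (Complex.log w), by rw [E, θ_θinv, Complex.exp_log hw]⟩

/-- The kernel generator `τ = θ⁻¹(2πi)`. [folklore] -/
def τ : ℂ := S.θinv (2 * Real.pi * I)

/-- `θ τ = 2πi`. [folklore] -/
theorem θ_τ : S.θ S.τ = 2 * Real.pi * I := S.θ_θinv _

/-- `τ ≠ 0`. [folklore] -/
theorem τ_ne_zero : S.τ ≠ 0 := by
  intro h
  have h1 := S.θ_τ
  rw [h, θ_zero] at h1
  have h2 : (2 * (Real.pi : ℂ) * I).im = 0 := by rw [← h1]; simp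
  simp [Real.pi_ne_zero] at h2

/-- `conj τ = −τ` (`θ⁻¹` commutes with `conj` and `conj (2πi) = −2πi`). [folklore] -/
theorem conj_τ : (starRingEnd ℂ) S.τ = -S.τ := by
  have h2 : (starRingEnd ℂ) (2 : ℂ) = 2 := by
    rw [show (2 : ℂ) = ((2 : ℝ) : ℂ) by norm_num, Complex.conj_ofReal]
  have h : (starRingEnd ℂ) (2 * (Real.pi : ℂ) * I) = -(2 * Real.pi * I) := by
    rw [map_mul, map_mul, h2, Complex.conj_ofReal, Complex.conj_I, mul_neg]
  rw [τ, ← θinv_conj, h, θinv_neg]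

/-- The kernel of `E` is the cyclic group `ℤ τ`. [folklore] -/
theorem E_eq_one_iff (z : ℂ) : S.E z = 1 ↔ ∃ n : ℤ, z = n * S.τ := by
  rw [E, Complex.exp_eq_one_iff]
  constructor
  · rintro ⟨n, hn⟩
    refine ⟨n, S.θ_injective ?_⟩
    rw [hn, θ_intCast_mul, θ_τ]
  · rintro ⟨n, rfl⟩
    exact ⟨n, by rw [θ_intCast_mul, θ_τ]⟩

/-- `E (τ / n) = e^{2πi/n}`: the torsion of `E` is the standard one. [folklore] -/
theorem E_τ_div_natCast (n : ℕ) : S.E (S.τ / n) = cexp (2 * Real.pi * I / n) := by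
  rw [E, div_eq_inv_mul, S.θ_mul_of_mem (inv_mem (natCast_mem Qb n)), θ_τ, inv_mul_eq_div]

/-- Polar dictionary, real axis: `E x = e^{x + φ(x) d} > 0`. [folklore] -/
theorem E_ofReal (x : ℝ) : S.E x = ((Real.exp (x + S.φR x * S.d) : ℝ) : ℂ) := by
  rw [E, θ_ofReal, Complex.ofReal_exp]

/-- `E` maps `ℝ` into `ℝ_{>0}`. [folklore] -/
theorem E_ofReal_pos (x : ℝ) : ∃ t : ℝ, 0 < t ∧ S.E x = t :=
  ⟨_, Real.exp_pos _, S.E_ofReal x⟩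

/-- `E : ℝ → ℝ_{>0}` is onto (`θ⁻¹` preserves `ℝ`). [folklore] -/
theorem E_real_onto_pos {t : ℝ} (ht : 0 < t) : ∃ x : ℝ, S.E x = t := by
  refine ⟨Real.log t - S.φR (Real.log t) * S.d * S.c⁻¹, ?_⟩
  rw [← θinv_ofReal, E, θ_θinv, ← Complex.ofReal_exp, Real.exp_log ht]

/-- Polar dictionary, imaginary axis: `|E(iy)| = 1`. [folklore] -/
theorem norm_E_ofReal_mul_I (y : ℝ) : ‖S.E ((y : ℂ) * I)‖ = 1 := by
  rw [E, θ_ofReal_mul_I]; exact Complex.norm_exp_ofReal_mul_I _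

/-- `E : iℝ → S¹` is onto (`θ⁻¹` preserves `iℝ`). [folklore] -/
theorem E_imag_onto_circle {w : ℂ} (hw : ‖w‖ = 1) : ∃ y : ℝ, S.E ((y : ℂ) * I) = w := by
  refine ⟨Complex.arg w - S.φR (Complex.arg w) * S.d * S.c⁻¹, ?_⟩
  have h1 : ((Complex.arg w - S.φR (Complex.arg w) * S.d * S.c⁻¹ : ℝ) : ℂ) * I =
      S.θinv ((Complex.arg w : ℂ) * I) := by
    apply Complex.ext <;> simp [φR_zero]
  rw [h1, E, θ_θinv]
  have h2 := Complex.norm_mul_exp_arg_mul_I w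
  rw [hw] at h2
  simpa using h2

/-- What the package does not see: for a non-trivial shear (`ℓ ≠ u`) the sheared exponential is
DISCONTINUOUS on the real axis. Indeed `E x = e^{x + φ(x) d}` for real `x`; continuity would make
the additive map `φ` continuous, hence `ℝ`-linear (`map_real_smul`), hence zero since `φ 1 = 0` —
contradicting `φ u = 1`. [folklore] -/
theorem not_continuous_E_ofReal (hd : S.d ≠ 0) : ¬ Continuous fun x : ℝ => S.E x := by
  intro hc
  have h1 : Continuous fun x : ℝ => Real.exp (x + S.φR x * S.d) := by
    have h : (fun x : ℝ => Real.exp (x + S.φR x * S.d)) = fun x : ℝ => (S.E x).re := by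
      funext x
      rw [S.E_ofReal x, Complex.ofReal_re]
    rw [h]
    exact Complex.continuous_re.comp hc
  have h2 : Continuous fun x : ℝ => x + S.φR x * S.d := by
    have h : (fun x : ℝ => x + S.φR x * S.d) =
        fun x : ℝ => Real.log (Real.exp (x + S.φR x * S.d)) := by
      funext x
      rw [Real.log_exp]
    rw [h]
    exact h1.log fun x => (Real.exp_pos _).ne'
  have h3 : Continuous S.φR := by
    have h : S.φR = fun x : ℝ => ((x + S.φR x * S.d) - x) * S.d⁻¹ := by
      funext x
      field_simp
      ring
    rw [h]
    exact ((h2.sub continuous_id).mul continuous_const)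
  let ψ : ℝ →+ ℝ :=
    { toFun := S.φR, map_zero' := S.φR_zero, map_add' := S.φR_add }
  have h4 : ψ (S.u • (1 : ℝ)) = S.u • ψ 1 := map_real_smul ψ h3 S.u 1
  have h5 : S.φR (S.u • (1 : ℝ)) = S.u • S.φR 1 := h4
  rw [smul_eq_mul, mul_one, S.φR_u, S.φR_one, smul_eq_mul, mul_zero] at h5
  exact one_ne_zero h5

/-- Hence a non-trivially sheared exponential is not continuous on `ℂ` either. [folklore] -/
theorem not_continuous_E (hd : S.d ≠ 0) : ¬ Continuous S.E := fun hc =>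
  S.not_continuous_E_ofReal hd (hc.comp Complex.continuous_ofReal)

/-! ## §4 Agreement with `exp` on `ℚ̄` and the transfer of LW / HL / GS / Baker -/

/-- `E = exp` on `ℚ̄` (`θ` fixes `ℚ̄`). [folklore] -/
theorem E_of_mem_Qb {q : ℂ} (hq : q ∈ Qb) : S.E q = cexp q := by
  rw [E, S.θ_of_mem hq]

/-- `E q = e^q` for algebraic `q`. [folklore] -/
theorem E_of_isAlgebraic {q : ℂ} (hq : IsAlgebraic ℚ q) : S.E q = cexp q :=
  S.E_of_mem_Qb (mem_Qb_iff.mpr hq)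

/-- Along a logarithm: `E (β l) = e^{β θ(l)}` for algebraic `β`, where `e^{θ l} = E l`.
[folklore] -/
theorem E_mul_of_isAlgebraic {β : ℂ} (hβ : IsAlgebraic ℚ β) (l : ℂ) :
    S.E (β * l) = cexp (β * S.θ l) := by
  rw [E, S.θ_mul_of_mem (mem_Qb_iff.mpr hβ)]

open Literature.NumberTheory.Transcendental in
/-- Hermite–Lindemann holds for `E` verbatim. [cite: Lindemann1882] -/
theorem hermiteLindemann_E {α : ℂ} (hα : IsAlgebraic ℚ α) (h0 : α ≠ 0) :
    Transcendental ℚ (S.E α) := by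
  rw [S.E_of_isAlgebraic hα]; exact transcendental_exp_holds hα h0

open Literature.NumberTheory.Transcendental in
/-- Lindemann–Weierstrass holds for `E` verbatim. [cite: Weierstrass1885] -/
theorem lindemannWeierstrass_E {ι : Type*} (α : ι → ℂ) (halg : ∀ i, IsAlgebraic ℚ (α i))
    (hli : LinearIndependent ℚ α) : AlgebraicIndependent ℚ fun i => S.E (α i) := by
  have h : (fun i => S.E (α i)) = fun i => cexp (α i) :=
    funext fun i => S.E_of_isAlgebraic (halg i)
  rw [h]; exact algebraicIndependent_exp_holds α halg hli

open Literature.NumberTheory.Transcendental in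
/-- Gelfond–Schneider holds for `E` verbatim (for `E`-logarithms `l` of algebraic `a`).
[cite: Gelfond1934] -/
theorem gelfondSchneider_E {a b l : ℂ} (ha : IsAlgebraic ℚ a) (hb : IsAlgebraic ℚ b)
    (hbq : b ∉ Set.range ((↑) : ℚ → ℂ)) (hl : S.E l = a) (hl0 : l ≠ 0) :
    Transcendental ℚ (S.E (b * l)) := by
  rw [S.E_mul_of_isAlgebraic hb]
  have hθl : cexp (S.θ l) = a := hl
  have hθl0 : S.θ l ≠ 0 := fun h => hl0 (S.θ_injective (by rw [h, θ_zero]))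
  exact gelfond_schneider_holds ha hb hbq hθl hθl0

open Literature.NumberTheory.Transcendental in
/-- Baker's theorem holds for `E` verbatim: `E`-logarithms of algebraic numbers, `ℚ`-free, are
`ℚ̄`-free together with `1`. (Uses that `θ` is `ℚ̄`-linear with `θ 1 = 1`.) [cite: Baker1966, 68] -/
theorem baker_E {ι : Type*} (l : ι → ℂ) (halg : ∀ i, IsAlgebraic ℚ (S.E (l i)))
    (hli : LinearIndependent ℚ l) :
    LinearIndependent Qb fun o : Option ι => o.elim 1 l := by
  have h1 : LinearIndependent Qb fun o : Option ι => o.elim (1 : ℂ) (S.θ ∘ l) :=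
    baker_holds (S.θ ∘ l) halg (S.linearIndependent_θ hli)
  have h2 : (fun o : Option ι => o.elim (1 : ℂ) (S.θ ∘ l)) =
      S.θQb ∘ fun o : Option ι => o.elim 1 l := by
    funext o; cases o <;> simp [θ_one]
  rw [h2] at h1
  exact LinearIndependent.of_comp _ h1

end Shear

end Summit.Schanuel.Schanuel.Theorems.RootDecomp1BTranscendencePackageFloor

end
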